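import Literature.Probability.Percolation.CorrelationLengthDKTAssembly
import Literature.Probability.Percolation.CerfUniquenessZoneBound
import HarnessLib

/-!
# DKT 2020, Theorem 2 (subcritical): reduction to the sharp-threshold step (Proposition 5) alone

Topic `Literature/Probability/Percolation`. With Proposition 1 of Duminil-Copin–Kozma–Tassion
2020 now PROVED for bond percolation uniformly on `p ∈ [δ, 1−δ]` (`AKN.dkt_prop1`,
`CerfUniquenessZoneBound.lean`), the assembly `DKT20.thm2_subcritical_of_prop1_prop5_Icc`
(`CorrelationLengthDKTAssembly.lean`: Prop. 1 → Prop. 5 → Theorem 2 subcritical) leaves the named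
fact `DuminilcopinKozmaTassion2020_thm2_subcritical` (`CorrelationLengthDKT.lean`) depending on the
sharp-threshold input (DKT Proposition 5, proved in the paper from Talagrand's inequality and
their Lemma 6) only: `DKT20.thm2_subcritical_of_prop5`.

## References

* H. Duminil-Copin, G. Kozma, V. Tassion, *Upper bounds on the percolation correlation length*,
  arXiv:1902.03207, Theorem 2, Propositions 1 and 5, §§4–7 [DuminilcopinKozmaTassion2020].
-/

noncomputable section

namespace Literature.Probability.Percolation

namespace DKT20

open _root_.MeasureTheory LatticeModels

/-- **DKT 2020, Theorem 2 (subcritical) from Proposition 5 alone.** If the sharp-threshold step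
holds — for `d ≥ 3`, `δ > 0`, `β ∈ (0,1)` there are `C, n₅` such that for `n ≥ n₅` and
`δ ≤ p`, `q ≤ 1 − δ` with the finite-size input `φ_p(S) ≥ e^{−1}` on the origin sets of `Λ_n`
and `q ≥ p + C/√(log n)`, one has `P_q(Λ_{⌊n^β⌋} ↔ ∂Λ_n in Λ_n) ≥ 1 − e^{−√(log n)}` — then
`DuminilcopinKozmaTassion2020_thm2_subcritical` holds: Proposition 1 is supplied by `AKN.dkt_prop1`.
[cite: DuminilcopinKozmaTassion2020, Thm 2 and Props 1, 5] -/
theorem thm2_subcritical_of_prop5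
    (h5 : ∀ d : ℕ, 3 ≤ d → ∀ δ : ℝ, 0 < δ → ∀ β : ℝ, 0 < β → β < 1 → ∃ C : ℝ, 0 < C ∧ ∃ n₅ : ℕ,
      ∀ n : ℕ, n₅ ≤ n → ∀ p q : unitInterval, δ ≤ (p : ℝ) → (q : ℝ) ≤ 1 - δ →
        (∀ S ∈ DCT16.originSets d n, Real.exp (-1) ≤ DCT16.phi p S) →
        (p : ℝ) + C / Real.sqrt (Real.log n) ≤ q →
        1 - Real.exp (-Real.sqrt (Real.log n)) ≤
          (bondPercolation (zdGraph d) q).real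
            (linkEvent (box d ⌊(n : ℝ) ^ β⌋₊) (innerBoundary (zdGraph d) (box d n)) n)) :
    DuminilcopinKozmaTassion2020_thm2_subcritical :=
  thm2_subcritical_of_prop1_prop5_Icc (fun d hd δ hδ => AKN.dkt_prop1 (d := d) (by omega) hδ) h5

end DKT20

end Literature.Probability.Percolation

end
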